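import Mathlib
import HarnessLib
import Summits.NavierStokesRegularity.NavierStokesRegularity.Theses.AxisymmetricExtremality
import Summits.NavierStokesRegularity.NavierStokesRegularity.Theorems.AxisymmetricExtremalityAxisymmetricKatoGlobalNoSwirlStratum
import Literature.Analysis.FluidPDE.LiouvilleExcludesLocalTypeI

/-!
# Strategist census s20-g3 (independent, family `s`) — typed signatures for
# `STRATEGY-CENSUS-s20-g3.md` on the crux `AxisymmetricKatoGlobal` (stmt-NavierStokesRegularity-15453)

Nothing here is a route item or a registered stub. Every `theorem` below is sorry-free logic over
existing declarations; the `def`s are the candidate statements examined under the census headings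
(Weaker intermediate / Decomposition / Transfer / Strengthen / Negation).
-/

namespace Summit.NavierStokesRegularity.NavierStokesRegularity.Cruxes.AxisymmetricKatoGlobal.StrategistS20g3

open MeasureTheory
open Literature.Analysis.FluidPDE Literature.Analysis.FunctionSpaces
open Summit.NavierStokesRegularity.NavierStokesRegularity.Theses.AxisymmetricExtremality

/-- The crux's written-out axisymmetry clause (`IsAxisymmetric u₀` unfolded). -/
def AxisymClause (u₀ : EuclideanSpace ℝ (Fin 3) → EuclideanSpace ℝ (Fin 3)) : Prop :=
  ∀ (θ : ℝ) (x : EuclideanSpace ℝ (Fin 3)),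
    u₀ (WithLp.toLp 2 ![Real.cos θ * x 0 - Real.sin θ * x 1, Real.sin θ * x 0 + Real.cos θ * x 1, x 2]) =
      WithLp.toLp 2 ![Real.cos θ * u₀ x 0 - Real.sin θ * u₀ x 1, Real.sin θ * u₀ x 0 + Real.cos θ * u₀ x 1, u₀ x 2]

theorem axisymClause_iff (u₀ : EuclideanSpace ℝ (Fin 3) → EuclideanSpace ℝ (Fin 3)) :
    AxisymClause u₀ ↔ IsAxisymmetric u₀ := Iff.rfl

/-! ## §1 Weaker intermediate: the threshold instance `T₀` that `closes` actually consumes -/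

/-- `T₀`: no axisymmetric Rusin–Šverák minimal blow-up datum, at any viscosity. This is the ONLY use
`closes` makes of the crux (`exact hnot (h₃ ν hν u₁ g hL3 hrep hdiv₁ hax)` at a minimal datum). -/
def NoAxisymMinimalDatum : Prop :=
  ∀ ν : ℝ, 0 < ν → ∀ (u₀ : EuclideanSpace ℝ (Fin 3) → EuclideanSpace ℝ (Fin 3))
    (g : HomSobolev (EuclideanSpace ℝ (Fin 3)) (EuclideanSpace ℂ (Fin 3)) (1 / 2 : ℝ)),
    IsMinimalBlowupDatum ν u₀ g → AxisymClause u₀ → False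

/-- crux ⇒ T₀ (T₀ is weaker). -/
theorem noAxisymMinimalDatum_of_crux (h : AxisymmetricKatoGlobal) : NoAxisymMinimalDatum := by
  intro ν hν u₀ g hmin hax
  obtain ⟨hL3, hrep, hdiv, -, hnot⟩ := hmin
  exact hnot (h ν hν u₀ g hL3 hrep hdiv hax)

/-- `closes` re-run with `T₀` in place of the crux: the route's deciding theorem needs no more. -/
theorem summit_of_noAxisymMinimalDatum (h₂ : MinimalDatumPFold) (h₄ : PFoldToAxisymmetric)
    (h₀ : NoAxisymMinimalDatum) : _root_.NavierStokesRegularity := by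
  show Literature.NS.NavierStokesExistenceSmoothR3
  intro ν hν u₀ hsm hdiv hdec
  by_contra hno
  obtain ⟨u₁, g, hmin, hax⟩ := h₄ ν hν (h₂ ν hν ⟨u₀, hsm, hdiv, hdec, hno⟩)
  exact h₀ ν hν u₁ g hmin hax

/-- `T₀` unfolded: the crux restricted to the threshold sphere `‖g‖_{Ḣ^{1/2}} = ρ_max^pure(ν)`. -/
def AxisymKatoGlobalAtThreshold : Prop :=
  ∀ ν : ℝ, 0 < ν → ∀ (u₀ : EuclideanSpace ℝ (Fin 3) → EuclideanSpace ℝ (Fin 3))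
    (g : HomSobolev (EuclideanSpace ℝ (Fin 3)) (EuclideanSpace ℂ (Fin 3)) (1 / 2 : ℝ)),
    MemLp u₀ 3 volume → g.Represents (Literature.Analysis.FunctionSpaces.EuclideanSpace.complexify ∘ u₀) →
    IsWeaklyDivFree u₀ → ‖g‖ₑ = rusinSverakRhoMaxPure ν → AxisymClause u₀ → HasGlobalKatoSolution ν u₀

theorem noAxisymMinimalDatum_iff_atThreshold : NoAxisymMinimalDatum ↔ AxisymKatoGlobalAtThreshold := by
  constructor
  · intro h ν hν u₀ g hL3 hrep hdiv hnorm hax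
    by_contra hnot
    exact h ν hν u₀ g ⟨hL3, hrep, hdiv, hnorm, hnot⟩ hax
  · intro h ν hν u₀ g hmin hax
    obtain ⟨hL3, hrep, hdiv, hnorm, hnot⟩ := hmin
    exact hnot (h ν hν u₀ g hL3 hrep hdiv hnorm hax)

/-- The swirl-free sub-instance of `T₀` is a THEOREM (landed no-swirl stratum, every `ν`). This is
the instance a dihedral (`D_{2^k}`) re-typing of the UPSTREAM crux `MinimalDatumPFold` would let
`closes` consume (crux idea `Ideas/dihedral-smith-bypass.md`) — a route-level move, not a strategy
for this crux. -/
theorem noAxisymMinimalDatum_noSwirl {ν : ℝ} (hν : 0 < ν)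
    {u₀ : EuclideanSpace ℝ (Fin 3) → EuclideanSpace ℝ (Fin 3)}
    {g : HomSobolev (EuclideanSpace ℝ (Fin 3)) (EuclideanSpace ℂ (Fin 3)) (1 / 2 : ℝ)}
    (hmin : IsMinimalBlowupDatum ν u₀ g) (hax : AxisymClause u₀) (hsw : HasNoSwirl u₀) : False := by
  obtain ⟨hL3, _hrep, hdiv, -, hnot⟩ := hmin
  exact hnot
    (Summit.NavierStokesRegularity.NavierStokesRegularity.Theorems.AxisymmetricKatoGlobal.NoSwirlStratum.axisymmetricKatoGlobal_noSwirl_stratum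
      ν hν u₀ hL3 hdiv (fun θ x => hax θ x) hsw)

/-! ## §2 Decomposition candidate D3 (recorded, NOT filed): Clay-data restriction + critical-data transfer -/

/-- D3 piece 1: the crux on Clay data (smooth, divergence-free, rapidly decaying, axisymmetric) —
the conjecture leaf ns.S25 in Kato form. -/
def AxisymKatoGlobalClayData : Prop :=
  ∀ ν : ℝ, 0 < ν → ∀ u₀ : EuclideanSpace ℝ (Fin 3) → EuclideanSpace ℝ (Fin 3),
    ContDiff ℝ (⊤ : ℕ∞) u₀ → NSWave0.IsDivFree u₀ → HasRapidSpatialDecay u₀ → AxisymClause u₀ →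
    HasGlobalKatoSolution ν u₀

/-- D3 piece 2: transfer from Clay data to critical (`L³ ∩ Ḣ^{1/2}`) data. -/
def ClayToCriticalTransfer : Prop := AxisymKatoGlobalClayData → AxisymmetricKatoGlobal

/-- D3 assembly (modus ponens; `trivial_seam`). -/
theorem crux_of_D3 (h₁ : AxisymKatoGlobalClayData) (h₂ : ClayToCriticalTransfer) :
    AxisymmetricKatoGlobal := h₂ h₁

/-- Converse bookkeeping: piece 1 is implied by the crux (via the proved support `ClayDatumCritical`). -/
theorem clayData_of_crux (hcc : ClayDatumCritical) (h : AxisymmetricKatoGlobal) :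
    AxisymKatoGlobalClayData := by
  intro ν hν u₀ hsm hdiv hdec hax
  obtain ⟨hL3, hwdiv, g, hrep⟩ := hcc u₀ hsm hdiv hdec
  exact h ν hν u₀ g hL3 hrep hwdiv hax

/-! ## §3/§4 Transfer / Strengthen: what the KNSS Liouville conjecture buys (Type I only) -/

/-- In tree (Albritton–Barker 2019 §1): the Liouville conjecture for bounded mild ancient solutions
excludes LOCAL TYPE I singular points — and nothing is recorded for Type II. -/
example : Literature.Analysis.FluidPDE.LiouvilleConjectureNS →
    ¬ Literature.Analysis.FluidPDE.LocalTypeISingularityExists :=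
  Literature.Analysis.FluidPDE.LiouvilleConjectureNS.not_localTypeISingularityExists

/-- `R_ε`: the ABSOLUTE small-swirl rung of the crux (`sup |Γ₀| ≤ ε ν`, `Γ = swirl = r u_θ`).
A strictly weaker special case; OPEN in print (Lei–Zhang 2017 Thm 1.4 / Chen–Fang–Zhang 2017 Thm 1.2
are RELATIVE smallness criteria). Not consumable by `closes` (a minimal datum need not have small swirl). -/
def AxisymKatoGlobalSmallSwirl : Prop :=
  ∃ ε : ℝ, 0 < ε ∧ ∀ ν : ℝ, 0 < ν → ∀ (u₀ : EuclideanSpace ℝ (Fin 3) → EuclideanSpace ℝ (Fin 3))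
    (g : HomSobolev (EuclideanSpace ℝ (Fin 3)) (EuclideanSpace ℂ (Fin 3)) (1 / 2 : ℝ)),
    MemLp u₀ 3 volume → g.Represents (Literature.Analysis.FunctionSpaces.EuclideanSpace.complexify ∘ u₀) →
    IsWeaklyDivFree u₀ → AxisymClause u₀ → (∀ x, |swirl u₀ x| ≤ ε * ν) → HasGlobalKatoSolution ν u₀

theorem smallSwirl_of_crux (h : AxisymmetricKatoGlobal) : AxisymKatoGlobalSmallSwirl :=
  ⟨1, one_pos, fun ν hν u₀ g hL3 hrep hdiv hax _ => h ν hν u₀ g hL3 hrep hdiv hax⟩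

/-! ## §5 Negation: the shape of a counterexample -/

/-- A single axisymmetric critical datum without a global Kato solution refutes the crux. -/
theorem not_crux_of_witness {ν : ℝ} (hν : 0 < ν)
    {u₀ : EuclideanSpace ℝ (Fin 3) → EuclideanSpace ℝ (Fin 3)}
    {g : HomSobolev (EuclideanSpace ℝ (Fin 3)) (EuclideanSpace ℂ (Fin 3)) (1 / 2 : ℝ)}
    (hL3 : MemLp u₀ 3 volume)
    (hrep : g.Represents (Literature.Analysis.FunctionSpaces.EuclideanSpace.complexify ∘ u₀))
    (hdiv : IsWeaklyDivFree u₀) (hax : AxisymClause u₀) (hno : ¬ HasGlobalKatoSolution ν u₀) :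
    ¬ AxisymmetricKatoGlobal :=
  fun h => hno (h ν hν u₀ g hL3 hrep hdiv hax)

end Summit.NavierStokesRegularity.NavierStokesRegularity.Cruxes.AxisymmetricKatoGlobal.StrategistS20g3
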